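import Mathlib.RepresentationTheory.Homological.GroupCohomology.Shapiro
import Mathlib.RepresentationTheory.Homological.GroupCohomology.Functoriality
import Mathlib.GroupTheory.Index
import Mathlib.Algebra.BigOperators.Finprod
import Mathlib.RingTheory.Finiteness.Basic
import HarnessLib

/-!
# `Hⁿ(G, A)` is a direct summand of `Hⁿ(S, A)` for a subgroup `S` of finite index invertible in `k`

Topic `Algebra/Homology`; namespace `Literature.Algebra.Homology`.  Mathlib only.

Let `S ≤ G` be a subgroup of finite index and `A` a `k`-linear representation of `G`.  The unit
`η : A ⟶ Coind_S^G Res_S A`, `a ↦ (x ↦ x a)` (`coindUnit`, Mathlib `Rep.resCoindToHom` of `𝟙`),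
has the `G`-equivariant "trace" `τ : Coind_S^G Res_S A ⟶ A`, `f ↦ ∑_{yS ∈ G/S} y f(y⁻¹)`
(`coindTrace`; the summand depends only on the coset `yS`), with **`η ≫ τ = [G : S] • 𝟙`**
(`coindUnit_comp_coindTrace`).  Applying `Hⁿ(G, -)` and Shapiro's isomorphism
`Hⁿ(G, Coind_S^G Res_S A) ≅ Hⁿ(S, A)` (`groupCohomology.coindIso`):

* `trace_comp_unit_apply` — `Hⁿ(τ) (Hⁿ(η) x) = [G : S] • x` on `Hⁿ(G, A)`;
* `map_coindUnit_injective` — if `[G : S]` acts injectively on `Hⁿ(G, A)` (e.g. `[G : S]`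
  invertible in `k`), `Hⁿ(η) : Hⁿ(G, A) → Hⁿ(G, Coind) ≅ Hⁿ(S, A)` is INJECTIVE (this composite
  is the restriction map; we do not need that identification);
* `isZero_of_isZero_subgroup` — then `Hⁿ(S, A) = 0 ⟹ Hⁿ(G, A) = 0`;
* `moduleFinite_of_moduleFinite_subgroup` — and, over a Noetherian `k`, `Hⁿ(S, A)` finitely
  generated `⟹ Hⁿ(G, A)` finitely generated.

This is the transfer-free form of "restriction followed by corestriction is multiplication by the
index" [Brown1982CohomologyGroups, III Prop. 9.5 and Prop. 10.1]: for virtually-`ℤ²` arithmetic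
groups (`Γ ⊇ ℤ²` of finite index) over a field of characteristic `0` it reduces vanishing and
finiteness of `Hⁿ(Γ, V)` to the lattice.

## References

* K. S. Brown, *Cohomology of Groups*, GTM 87 (1982), III (6.2), Prop. 9.5, Prop. 10.1
  [Brown1982CohomologyGroups].
-/

noncomputable section

open CategoryTheory CategoryTheory.Limits groupCohomology

universe u

namespace Literature.Algebra.Homology

variable {k G : Type u} [CommRing k] [Group G] (S : Subgroup G) (A : Rep.{u} k G)

/-! ### The unit `A ⟶ Coind_S^G Res_S A` -/

/-- The unit `η : A ⟶ Coind_S^G Res_S A`, `a ↦ (x ↦ x a)` (Mathlib's `resCoindToHom` of the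
identity of `Res_S A`). [cite: Brown1982CohomologyGroups, III (6.2)] -/
def coindUnit : A ⟶ Rep.coind S.subtype (Rep.res S.subtype A) :=
  Rep.resCoindToHom S.subtype A (Rep.res S.subtype A) (𝟙 _)

/-- Unfolding lemma: `(η a)(x) = x a`. [folklore] -/
@[simp]
theorem coindUnit_hom_apply_coe (a : A) (x : G) :
    (((coindUnit S A).hom a : Rep.coind S.subtype (Rep.res S.subtype A)) : G → A) x = A.ρ x a :=
  rfl

/-- Elements of `Coind_S^G Res_S A` satisfy `f(s x) = s f(x)`. [folklore] -/
theorem coind_apply_mul (f : Rep.coind S.subtype (Rep.res S.subtype A)) (s : S) (x : G) :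
    (f : G → A) ((s : G) * x) = A.ρ (s : G) ((f : G → A) x) :=
  f.2 s x

/-! ### The trace `Coind_S^G Res_S A ⟶ A` -/

/-- The summand `y f(y⁻¹)` of the trace depends only on the coset `y S`. [folklore] -/
theorem traceTerm_eq (f : Rep.coind S.subtype (Rep.res S.subtype A)) {y y' : G}
    (h : (y : G ⧸ S) = (y' : G ⧸ S)) :
    A.ρ y ((f : G → A) y⁻¹) = A.ρ y' ((f : G → A) y'⁻¹) := by
  obtain ⟨s, rfl⟩ : ∃ s : S, y' = y * s := by
    rw [QuotientGroup.eq] at h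
    exact ⟨⟨y⁻¹ * y', h⟩, by simp⟩
  have hs := coind_apply_mul S A f s⁻¹ y⁻¹
  rw [Subgroup.coe_inv] at hs
  rw [mul_inv_rev, hs, ← Module.End.mul_apply, ← map_mul, mul_assoc, mul_inv_cancel, mul_one]

/-- The summand of the trace as a function on `G ⧸ S`: `yS ↦ y f(y⁻¹)`. [folklore] -/
def traceTerm (f : Rep.coind S.subtype (Rep.res S.subtype A)) : G ⧸ S → A :=
  Quotient.lift (fun y : G => A.ρ y ((f : G → A) y⁻¹)) fun _ _ h =>
    traceTerm_eq S A f (Quotient.sound h)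

/-- Unfolding lemma. [folklore] -/
@[simp]
theorem traceTerm_mk (f : Rep.coind S.subtype (Rep.res S.subtype A)) (y : G) :
    traceTerm S A f (y : G ⧸ S) = A.ρ y ((f : G → A) y⁻¹) := rfl

variable [S.FiniteIndex]

attribute [local instance] Subgroup.fintypeQuotientOfFiniteIndex

/-- The trace `τ f = ∑_{yS ∈ G/S} y f(y⁻¹)` (a finite sum, `S` of finite index), as a linear map.
[cite: Brown1982CohomologyGroups, III §9] -/
def coindTraceLinear : Rep.coind S.subtype (Rep.res S.subtype A) →ₗ[k] A where
  toFun f := ∑ c : G ⧸ S, traceTerm S A f c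
  map_add' f f' := by
    rw [← Finset.sum_add_distrib]
    refine Finset.sum_congr rfl fun c _ => ?_
    induction c using QuotientGroup.induction_on with
    | H y => simp
  map_smul' r f := by
    rw [RingHom.id_apply, Finset.smul_sum]
    refine Finset.sum_congr rfl fun c _ => ?_
    induction c using QuotientGroup.induction_on with
    | H y => simp

/-- Unfolding lemma. [folklore] -/
theorem coindTraceLinear_apply (f : Rep.coind S.subtype (Rep.res S.subtype A)) :
    coindTraceLinear S A f = ∑ c : G ⧸ S, traceTerm S A f c := rfl

/-- **The trace is `G`-equivariant**: `τ(g f) = g τ(f)` (reindex the cosets by `yS ↦ g y S`).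
[cite: Brown1982CohomologyGroups, III §9] -/
theorem coindTraceLinear_ρ (g : G) (f : Rep.coind S.subtype (Rep.res S.subtype A)) :
    coindTraceLinear S A ((Rep.coind S.subtype (Rep.res S.subtype A)).ρ g f) =
      A.ρ g (coindTraceLinear S A f) := by
  rw [coindTraceLinear_apply, coindTraceLinear_apply, map_sum,
    ← Equiv.sum_comp (MulAction.toPerm g : Equiv.Perm (G ⧸ S))]
  refine Finset.sum_congr rfl fun c _ => ?_
  induction c using QuotientGroup.induction_on with
  | H y =>
  change traceTerm S A _ (g • (y : G ⧸ S)) = A.ρ g (A.ρ y ((f : G → A) y⁻¹))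
  rw [MulAction.Quotient.smul_coe, smul_eq_mul, traceTerm_mk]
  change A.ρ (g * y) ((f : G → A) ((g * y)⁻¹ * g)) = _
  rw [mul_inv_rev, inv_mul_cancel_right, map_mul, Module.End.mul_apply]

/-- **The trace** `τ : Coind_S^G Res_S A ⟶ A` as a morphism of `G`-representations.
[cite: Brown1982CohomologyGroups, III §9] -/
def coindTrace : Rep.coind S.subtype (Rep.res S.subtype A) ⟶ A :=
  Rep.ofHom (LinearMap.intertwiningMap_of_isIntertwiningMap
    (Rep.coind S.subtype (Rep.res S.subtype A)).ρ A.ρ (coindTraceLinear S A)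
    fun g f => coindTraceLinear_ρ S A g f)

/-- Unfolding lemma. [folklore] -/
theorem coindTrace_hom_apply (f : Rep.coind S.subtype (Rep.res S.subtype A)) :
    (coindTrace S A).hom f = ∑ c : G ⧸ S, traceTerm S A f c := rfl

/-- **`τ (η a) = [G : S] • a`.** [cite: Brown1982CohomologyGroups, III Prop. 9.5] -/
theorem coindTrace_coindUnit_apply (a : A) :
    (coindTrace S A).hom ((coindUnit S A).hom a) = S.index • a := by
  rw [coindTrace_hom_apply]
  have hterm : ∀ c : G ⧸ S, traceTerm S A ((coindUnit S A).hom a) c = a := fun c => by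
    induction c using QuotientGroup.induction_on with
    | H y =>
    rw [traceTerm_mk, coindUnit_hom_apply_coe, ← Module.End.mul_apply, ← map_mul, mul_inv_cancel,
      map_one, Module.End.one_apply]
  rw [Finset.sum_congr rfl fun c _ => hterm c, Finset.sum_const, Finset.card_univ,
    Subgroup.index_eq_card, Nat.card_eq_fintype_card]

/-- **`η ≫ τ = [G : S] • 𝟙`.** [cite: Brown1982CohomologyGroups, III Prop. 9.5] -/
theorem coindUnit_comp_coindTrace : coindUnit S A ≫ coindTrace S A = S.index • 𝟙 A := by
  refine Rep.hom_ext (Representation.IntertwiningMap.ext (LinearMap.ext fun a => ?_))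
  change (coindTrace S A).hom ((coindUnit S A).hom a) = (S.index • 𝟙 A : A ⟶ A).hom a
  rw [coindTrace_coindUnit_apply, Rep.nsmul_hom]
  rfl

/-! ### On cohomology -/

omit [S.FiniteIndex] in
/-- `Hⁿ(id, m • 𝟙) x = m • x`. [folklore] -/
theorem map_nsmul_id_apply (m : ℕ) (n : ℕ) (x : groupCohomology A n) :
    (groupCohomology.map (MonoidHom.id G) (m • 𝟙 A) n).hom x = m • x := by
  induction m with
  | zero =>
    rw [zero_smul, zero_smul]
    change (HomologicalComplex.homologyMap ((groupCohomology.cochainsFunctor k G).map 0) n).hom x = 0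
    rw [(groupCohomology.cochainsFunctor k G).map_zero, HomologicalComplex.homologyMap_zero]
    rfl
  | succ m ih =>
    rw [add_smul, one_smul, add_smul, one_smul]
    change (HomologicalComplex.homologyMap ((groupCohomology.cochainsFunctor k G).map
      (m • 𝟙 A + 𝟙 _)) n).hom x = _
    rw [(groupCohomology.cochainsFunctor k G).map_add, HomologicalComplex.homologyMap_add,
      ModuleCat.hom_add, LinearMap.add_apply]
    change (groupCohomology.map (MonoidHom.id G) (m • 𝟙 A) n).hom x +
      (groupCohomology.map (MonoidHom.id G) (𝟙 A) n).hom x = _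
    rw [ih, groupCohomology.map_id]
    rfl

/-- **`Hⁿ(τ) (Hⁿ(η) x) = [G : S] • x`** on `Hⁿ(G, A)`. [cite: Brown1982CohomologyGroups, III Prop. 9.5] -/
theorem trace_comp_unit_apply (n : ℕ) (x : groupCohomology A n) :
    (groupCohomology.map (MonoidHom.id G) (coindTrace S A) n).hom
        ((groupCohomology.map (MonoidHom.id G) (coindUnit S A) n).hom x) = S.index • x := by
  have h := congrArg (fun φ => (groupCohomology.map (MonoidHom.id G) φ n).hom x)
    (coindUnit_comp_coindTrace S A)
  change (groupCohomology.map (MonoidHom.id G) (coindUnit S A ≫ coindTrace S A) n).hom x =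
    (groupCohomology.map (MonoidHom.id G) (S.index • 𝟙 A) n).hom x at h
  rw [groupCohomology.map_id_comp, ModuleCat.hom_comp, LinearMap.comp_apply, map_nsmul_id_apply] at h
  exact h

/-- **`Hⁿ(η) : Hⁿ(G, A) → Hⁿ(G, Coind_S^G Res_S A) ≅ Hⁿ(S, A)` is injective** as soon as the
index `[G : S]` acts injectively on `Hⁿ(G, A)` (e.g. is invertible in `k`). [cite: Brown1982CohomologyGroups, III Prop. 10.1] -/
theorem map_coindUnit_injective (n : ℕ)
    (hreg : ∀ x : groupCohomology A n, S.index • x = 0 → x = 0) :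
    Function.Injective (groupCohomology.map (MonoidHom.id G) (coindUnit S A) n).hom := by
  intro x y hxy
  have h := congrArg (groupCohomology.map (MonoidHom.id G) (coindTrace S A) n).hom hxy
  rw [trace_comp_unit_apply, trace_comp_unit_apply] at h
  have h0 : S.index • (x - y) = 0 := by rw [smul_sub, h, sub_self]
  exact sub_eq_zero.1 (hreg _ h0)

omit [S.FiniteIndex] in
/-- If the index is a unit of `k`, it acts injectively on every `k`-module. [folklore] -/
theorem eq_zero_of_index_smul_eq_zero (hunit : IsUnit ((S.index : ℕ) : k)) {M : Type*}
    [AddCommGroup M] [Module k M] (x : M) (hx : S.index • x = 0) : x = 0 := by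
  obtain ⟨u, hu⟩ := hunit
  have h : (u : k) • x = 0 := by rw [hu, Nat.cast_smul_eq_nsmul]; exact hx
  have := congrArg (fun y => (u⁻¹ : kˣ) • y) h
  simpa only [Units.smul_def, smul_zero, ← mul_smul, Units.inv_mul, one_smul] using this

omit [S.FiniteIndex] in
/-- Elements of a zero module are equal. [folklore] -/
private theorem subsingleton_of_isZero {X : ModuleCat.{u} k} (h : IsZero X) : Subsingleton X :=
  ⟨fun a b => by
    have hab : (𝟙 X : X ⟶ X).hom a = (𝟙 X : X ⟶ X).hom b := by rw [h.eq_of_src (𝟙 X) 0]; rfl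
    exact hab⟩

/-- **`Hⁿ(S, A) = 0 ⟹ Hⁿ(G, A) = 0`** for `S` of finite index invertible in `k`: `Hⁿ(G, A)` embeds
into `Hⁿ(G, Coind_S^G Res_S A) ≅ Hⁿ(S, A)`. [cite: Brown1982CohomologyGroups, III Prop. 10.1] -/
theorem isZero_of_isZero_subgroup (hunit : IsUnit ((S.index : ℕ) : k)) (n : ℕ)
    (hS : IsZero (groupCohomology (Rep.res S.subtype A) n)) : IsZero (groupCohomology A n) := by
  have hinj := map_coindUnit_injective S A n (fun x hx => eq_zero_of_index_smul_eq_zero S hunit x hx)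
  have hz : IsZero (groupCohomology (Rep.coind S.subtype (Rep.res S.subtype A)) n) :=
    hS.of_iso (groupCohomology.coindIso (Rep.res S.subtype A) n)
  have hsub := subsingleton_of_isZero hz
  haveI : Subsingleton (groupCohomology A n) := ⟨fun x y => hinj (Subsingleton.elim _ _)⟩
  exact ModuleCat.isZero_of_subsingleton _

/-- **`Hⁿ(S, A)` finitely generated `⟹ Hⁿ(G, A)` finitely generated** (Noetherian `k`, index
invertible in `k`). [cite: Brown1982CohomologyGroups, III Prop. 10.1] -/
theorem moduleFinite_of_moduleFinite_subgroup [IsNoetherianRing k] (hunit : IsUnit ((S.index : ℕ) : k))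
    (n : ℕ) (hS : Module.Finite k (groupCohomology (Rep.res S.subtype A) n)) :
    Module.Finite k (groupCohomology A n) := by
  have hinj := map_coindUnit_injective S A n (fun x hx => eq_zero_of_index_smul_eq_zero S hunit x hx)
  have hC : Module.Finite k (groupCohomology (Rep.coind S.subtype (Rep.res S.subtype A)) n) :=
    Module.Finite.equiv (groupCohomology.coindIso (Rep.res S.subtype A) n).toLinearEquiv.symm
  exact Module.Finite.of_injective _ hinj

end Literature.Algebra.Homology
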